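import Summits.HodgeConjecture.HodgeConjecture.Theorems.R90S6TwistedShellParityRankOne     -- ★ W11 FILE 2b: `isSelfDualLattice_glVertexAct_iff_of_valuation_det_eq` (brings ★ FILE 2 `dist_glVertexAct_thetaTreeIso_of_mul_mul_eq_zpowDiagGL`, FILE 1∕1b, (W1c)-A, ★ Cartan)
import Summits.HodgeConjecture.HodgeConjecture.Theorems.R90S6TwistedKappaClassFunction     -- ★ K4: `det_coe_inv_mul_mul_qsInvolution` (`det(g⁻¹δΘg) = det δ·(det g·σ det g)⁻¹`), `det_coe_qsInvolution`
import HarnessLib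

/-!
# R90 · S6 «Ch. 14.1–14.5 stable TF» — card W11, FILE 3: «COSETS = TYPED VERTICES» — the twisted Cartan shell `Shell(δ, a) ⊂ GL₂(E)⧸GL₂(𝒪)` counts the vertices of
# ONE `J`-type displaced by `τ_δ` by `a₀ − a₁` (`Theorems/R90S6TwistedShellCosetsRankOne.lean`; DAG E1.4.4.3.2 — the η̂_j-socket consumer shape at rank one)

Cell `hodgecm-mathlib`, crux H413 (`stmt-HodgeConjecture-24833`), route of record `HCCMUnconditional`; programme R90-TF, section S6 (base `R90-C14`),
seat K2Liu-p27 (g4); S6 dealer R90-C14-plan (g3) (R29) 03:44:34Z «then knock: W11 FILE 3 = the η̂_j-socket consumer shape, census-first»; census + heads R90 bus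
03:54:57Z.  Sequel of ★ FILE 2 `R90S6TwistedShellCountRankOne` (p865177) and ★ FILE 2b `R90S6TwistedShellParityRankOne` (p865263).  Lane `--supports
stmt-HodgeConjecture-24833 --as helper`; THEOREMS ONLY (no definition, no instance, no notation, no named-fact hypothesis, no `sorry`).

THE MATHEMATICS (Rogawski §4.10–4.11 pp. 56–60; Kottwitz, *Base change for unit elements* §1; Langlands, *Base change for GL(2)* §5).  The socket's `G̃`-side letter is
★ J1′ `Φ_Θ(δ, 𝟙_{K̃ϖ^aK̃}; ν∕t) = ν(K̃) · #Shell(δ, a)` with the TWISTED CARTAN SHELL (★ J1′ ∕ ★ L2-sgn letters verbatim, here at `K := E`, `N := 2`)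
  `Shell(δ, a) = {q : GL₂(E) ⧸ K̃ | q.out⁻¹ · δ · Θ(q.out) ∈ K̃ · ϖ^a · K̃}`,   `K̃ = glInt 2 E`, `ϖ^a = zpowDiagGL _ a`, `Θ = UnitaryGroup.qsInvolution σ`.
The map `q ↦ q.out • v₀` sends `GL₂(E)⧸K̃` onto the vertices of the tree `X` of `GL₂(E)` with fibre `ϖ^ℤ` (`Stab v₀ = E^× K̃`), and membership in the shell PINS the fibre
coordinate: `det(g⁻¹δΘ(g)) = det δ · (det g · σ det g)⁻¹` (★ K4), so `q ∈ Shell(δ, a)` forces `a₀ + a₁ = n − 2·ord det q.out` (`n = ord det δ`, binder `hδ : |det δ| = |ϖⁿ|`),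
while `ord det g (mod 2)` is the `J`-TYPE of `g • v₀` (★ FILE 2b §1).  Writing `a₀ + a₁ + 2m = n`:
* §1 letters of a shell member: **`dist_glVertexAct_out_root_of_mem_twistedShell`** (`d(q.out•v₀, τ_δ(q.out•v₀)) = a₀ − a₁`, ★ FILE 2's dictionary),
  **`valuation_det_out_eq_of_mem_twistedShell`** (`|det q.out| = |ϖ^m|`), **`isSelfDualLattice_glVertexAct_root_iff_even`** (`g • v₀` is `J`-self-dual iff `ord det g` is even);
* §2 **`bijOn_twistedShell_two`**: `q ↦ q.out • v₀` is a BIJECTION `Shell(δ, a) → {x ∈ V : d(x, τ_δ x) = a₀ − a₁ ∧ (x J-self-dual ↔ m even)}`, hence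
  **`ncard_twistedShell_two_eq_ncard_setOf_dist_and_type`** (`#Shell(δ, a) =` the number of `τ_δ`-displaced-by-`a₀−a₁` vertices of that ONE type) and
  **`twistedShell_two_finite_iff`** (the tree side pays ★ J1′'s `hfin`).  Wrong parity `a₀ + a₁ ≢ n` ⇒ `Shell = ∅` is ★ L2-sgn (S.6) (cited, not restated).
So `Φ_Θ(δ, 𝟙_{K̃ϖ^aK̃}) = ν(K̃) ·` a TYPED displacement-shell count of `τ_δ` on the `(q_E+1)`-regular tree — the typed ★ editions (W8-f `…_inter_type_…`, GF1, W8-f′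
`…_inter_type_of_inversion`) at `α = τ_δ` then give the values (FILE 3b).
HONEST LABEL: count layer of E1.4.4.3.2 (the `G̃`-side of the η̂_j clauses, Prop. 4.11.1 (b) ∕ L. 11.5.3), count-neutral until the socket consumes it; proves no printed global
statement; HC_CM is proved only modulo the 7 printed citations (2 remaining named inputs: hLiu418 = stmt-HodgeConjecture-24832, h413 = stmt-HodgeConjecture-24833) until rung 0
closes; REL ≠ ★ ≠ BUILT.

## References
* [Rogawski1990] J. D. Rogawski, *Automorphic Representations of Unitary Groups in Three Variables*, Ann. of Math. Stud. 123 (1990), §4.10–§4.11 pp. 56–60, L. 11.5.3 p. 155.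
* [Kottwitz1986BaseChangeUnits] R. Kottwitz, *Base change for unit elements of Hecke algebras*, Compositio Math. 60 (1986), §1 pp. 239–243.
* [Langlands1980AMS96] R. P. Langlands, *Base Change for GL(2)*, Ann. of Math. Stud. 96 (1980), §4–§5.
* [Serre1980Trees] J.-P. Serre, *Trees* (1980), Ch. II §1.1–§1.3.
-/

set_option autoImplicit false
-- the mandated namespace repeats the single-problem summit's segment (`HodgeConjecture.HodgeConjecture`)
set_option linter.dupNamespace false

noncomputable section

open scoped ValuativeRel Matrix MatrixGroups Pointwise
open Matrix ValuativeRel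
open Literature.NumberTheory.Automorphic Literature.NumberTheory.Automorphic.HermitianLatticeTree
open Literature.Combinatorics.SimpleGraph

namespace Summit.HodgeConjecture.HodgeConjecture.R90.S6

variable {E : Type*} [Field E] [ValuativeRel E] {ϖ : E} (hϖ : IsUniformizingElement ϖ) [IsDiscreteValuationRing 𝒪[E]]
  (σ : E →+* E) (hσv : ∀ x : E, valuation E (σ x) = valuation E x) (hσσ : ∀ x : E, σ (σ x) = x)

/-! ## §0 Valuation bookkeeping -/

section Bookkeeping

omit [IsDiscreteValuationRing 𝒪[E]] in
include hϖ in
/-- `|ϖᵃ| = |ϖᵇ| ⇒ a = b` (★ `IsUniformizingElement.eq_zero_of_zpow_mem`). [folklore] -/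
private theorem zpow_inj_of_valuation_eq {a b : ℤ} (h : valuation E (ϖ ^ a) = valuation E (ϖ ^ b)) : a = b := by
  have h0 := hϖ.ne_zero
  have hb0 : valuation E (ϖ ^ b) ≠ 0 := (Valuation.ne_zero_iff _).2 (zpow_ne_zero b h0)
  have hab : valuation E (ϖ ^ (a - b)) = 1 := by
    rw [zpow_sub₀ h0, map_div₀, h, div_self hb0]
  have h1 : ϖ ^ (a - b) ∈ 𝒪[E] := (Valuation.mem_integer_iff _ _).2 hab.le
  have h2 : ϖ ^ (-(a - b)) ∈ 𝒪[E] := (Valuation.mem_integer_iff _ _).2 (by rw [_root_.zpow_neg, map_inv₀, hab, inv_one])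
  have := hϖ.eq_zero_of_zpow_mem h1 h2
  omega

omit [IsDiscreteValuationRing 𝒪[E]] in
/-- Square roots in the value group: `x² = y² ⇒ x = y`. [folklore] -/
private theorem eq_of_pow_two_eq {x y : ValuativeRel.ValueGroupWithZero E} (h : x ^ 2 = y ^ 2) : x = y := by
  rcases lt_trichotomy x y with hlt | heq | hgt
  · exact absurd h (ne_of_lt (pow_lt_pow_left₀ hlt zero_le two_ne_zero))
  · exact heq
  · exact absurd h (ne_of_gt (pow_lt_pow_left₀ hgt zero_le two_ne_zero))

omit [ValuativeRel E] [IsDiscreteValuationRing 𝒪[E]] in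
/-- `det ϖ^a = ϖ^{a₀ + a₁}` at rank 2. [folklore] -/
private theorem det_coe_zpowDiagGL_two (h0 : ϖ ≠ 0) (a : Fin 2 → ℤ) :
    ((zpowDiagGL h0 a : GL (Fin 2) E) : Matrix (Fin 2) (Fin 2) E).det = ϖ ^ (a 0 + a 1) := by
  rw [coe_zpowDiagGL, Matrix.det_diagonal, Fin.prod_univ_two, ← zpow_add₀ h0]

omit [IsDiscreteValuationRing 𝒪[E]] in
/-- `|det (k₁ h k₂)| = |det h|` for `k₁, k₂ ∈ GL₂(𝒪)`, read on the Cartan datum `k₁ h k₂ = ϖ^a`: `|det h| = |ϖ^{a₀+a₁}|`. [cite: Serre1980Trees, Ch. II §1.1] -/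
private theorem valuation_det_eq_of_mul_mul_eq_zpowDiagGL (h0 : ϖ ≠ 0) {h k₁ k₂ : GL (Fin 2) E} {a : Fin 2 → ℤ}
    (hk₁ : k₁ ∈ glInt 2 E) (hk₂ : k₂ ∈ glInt 2 E) (hc : k₁ * h * k₂ = zpowDiagGL h0 a) :
    valuation E ((h : Matrix (Fin 2) (Fin 2) E).det) = valuation E (ϖ ^ (a 0 + a 1)) := by
  have hd := congrArg (fun g : GL (Fin 2) E => valuation E ((g : Matrix (Fin 2) (Fin 2) E).det)) hc
  simp only [Units.val_mul, Matrix.det_mul, map_mul, valuation_det_eq_one_of_mem_glInt hk₁, valuation_det_eq_one_of_mem_glInt hk₂, one_mul, mul_one,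
    det_coe_zpowDiagGL_two] at hd
  exact hd

omit [IsDiscreteValuationRing 𝒪[E]] in
include hσv in
/-- **`|det(g⁻¹ δ Θ(g))| · |det g|² = |det δ|`** (★ K4 `det_coe_inv_mul_mul_qsInvolution` + `|σ x| = |x|`). [cite: Rogawski1990, §4.10 p. 57] -/
private theorem valuation_det_twistedConj_mul_sq (g δ : GL (Fin 2) E) :
    valuation E (((g⁻¹ * δ * UnitaryGroup.qsInvolution σ g : GL (Fin 2) E)) : Matrix (Fin 2) (Fin 2) E).det *
        valuation E ((g : Matrix (Fin 2) (Fin 2) E).det) ^ 2 = valuation E (((δ : GL (Fin 2) E)) : Matrix (Fin 2) (Fin 2) E).det := by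
  have hg0 : valuation E ((g : Matrix (Fin 2) (Fin 2) E).det) ≠ 0 := (Valuation.ne_zero_iff _).2 (g.isUnit.map Matrix.detMonoidHom).ne_zero
  rw [det_coe_inv_mul_mul_qsInvolution, map_mul, map_inv₀, map_mul, hσv, ← pow_two, inv_mul_cancel_right₀ (pow_ne_zero 2 hg0)]

omit [IsDiscreteValuationRing 𝒪[E]] in
include hσv in
/-- `Θ(K̃) ⊆ K̃`: for `k ∈ GL₂(𝒪)`, `Θ(k) ∈ GL₂(𝒪)` — entries `σ` of entries of `k⁻¹` (★ `UnitaryGroup.coe_qsInvolution_apply`), determinant `(σ det k)⁻¹` (★ K4). [cite: Kottwitz1986BaseChangeUnits, §1 p. 240] -/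
private theorem qsInvolution_mem_glInt_two {k : GL (Fin 2) E} (hk : k ∈ glInt 2 E) : UnitaryGroup.qsInvolution σ k ∈ glInt 2 E := by
  have hkinv := isIntegralMatrix_of_mem_glInt (inv_mem hk)
  refine mem_glInt_of_isIntegralMatrix (fun i j => ?_) ?_
  · rw [UnitaryGroup.coe_qsInvolution_apply, Valuation.mem_integer_iff, hσv, ← Valuation.mem_integer_iff]
    exact hkinv _ _
  · rw [det_coe_qsInvolution, map_inv₀, hσv, valuation_det_eq_one_of_mem_glInt hk, inv_one]

omit [ValuativeRel E] [IsDiscreteValuationRing 𝒪[E]] in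
/-- `det ((c • 1) g) = c² det g`. [folklore] -/
private theorem det_scalar_map_mul (c : Eˣ) (g : GL (Fin 2) E) :
    ((c.map ((Matrix.scalar (Fin 2) : E →+* Matrix (Fin 2) (Fin 2) E) : E →* Matrix (Fin 2) (Fin 2) E) * g : GL (Fin 2) E) : Matrix (Fin 2) (Fin 2) E).det =
      (c : E) ^ 2 * (g : Matrix (Fin 2) (Fin 2) E).det := by
  rw [Units.val_mul, Units.coe_map, MonoidHom.coe_coe, Matrix.det_mul, Matrix.scalar_apply, Matrix.det_diagonal, Fin.prod_const]

omit [IsDiscreteValuationRing 𝒪[E]] in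
/-- A unit scalar `c • 1`, `|c| = 1`, lies in `GL₂(𝒪)`. [folklore] -/
private theorem scalar_map_mem_glInt {c : Eˣ} (hc : valuation E (c : E) = 1) :
    c.map ((Matrix.scalar (Fin 2) : E →+* Matrix (Fin 2) (Fin 2) E) : E →* Matrix (Fin 2) (Fin 2) E) ∈ glInt 2 E := by
  refine mem_glInt_of_isIntegralMatrix (fun i j => ?_) ?_
  · rw [Units.coe_map, MonoidHom.coe_coe, Matrix.scalar_apply, Matrix.diagonal_apply]
    split_ifs
    · exact (Valuation.mem_integer_iff _ _).2 hc.le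
    · exact zero_mem _
  · rw [Units.coe_map, MonoidHom.coe_coe, Matrix.scalar_apply, Matrix.det_diagonal, Fin.prod_const, map_pow, hc, one_pow]

end Bookkeeping

/-! ## §1 The letters of a shell member -/

section Member

include hσv in
/-- **A SHELL MEMBER IS DISPLACED BY `a₀ − a₁`**: if `q.out⁻¹ δ Θ(q.out) ∈ K̃ ϖ^a K̃` (`a` antitone) then `d(q.out • v₀, τ_δ(q.out • v₀)) = a₀ − a₁` (★ FILE 2's twisted shell
dictionary after unpacking the double coset). [cite: Rogawski1990, §4.11 pp. 58–60] [cite: Kottwitz1986BaseChangeUnits, §1 p. 240] -/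
theorem dist_glVertexAct_out_root_of_mem_twistedShell (δ : GL (Fin 2) E) {a : Fin 2 → ℤ} (ha : Antitone a)
    (v₀ : {M : Submodule 𝒪[E] (Fin 2 → E) // IsSpecialLattice (RingHom.id E) ϖ !![(0 : E), 1; -1, 0] M})
    (hv₀ : v₀.1 = latt (1 : Matrix (Fin 2) (Fin 2) E)) (q : GL (Fin 2) E ⧸ glInt 2 E)
    (hq : q.out⁻¹ * δ * UnitaryGroup.qsInvolution σ q.out ∈
      (glInt 2 E : Set (GL (Fin 2) E)) * {zpowDiagGL hϖ.ne_zero a} * (glInt 2 E : Set (GL (Fin 2) E))) :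
    (latticeTree (RingHom.id E) ϖ !![(0 : E), 1; -1, 0]).dist (glVertexAct hϖ q.out v₀)
        (glVertexAct hϖ δ (thetaTreeIso hϖ σ hσv hσσ (glVertexAct hϖ q.out v₀))) = (a 0 - a 1).toNat := by
  obtain ⟨x, hx, k₂, hk₂, hxk⟩ := Set.mem_mul.1 hq
  obtain ⟨k₁, hk₁, z, hz, rfl⟩ := Set.mem_mul.1 hx
  rw [Set.mem_singleton_iff] at hz
  subst hz
  refine dist_glVertexAct_thetaTreeIso_of_mul_mul_eq_zpowDiagGL hϖ σ hσv hσσ δ q.out v₀ hv₀ (inv_mem hk₁) (inv_mem hk₂) ha ?_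
  rw [← hxk]
  group

omit [IsDiscreteValuationRing 𝒪[E]] in
include hσv in
/-- **A SHELL MEMBER HAS `|det q.out| = |ϖ^m|`, `a₀ + a₁ + 2m = ord det δ`** — the shell pins the homothety coordinate of the coset (`|det(g⁻¹δΘg)|·|det g|² = |det δ|`).
[cite: Rogawski1990, §4.10 p. 57] [cite: Kottwitz1986BaseChangeUnits, §1 p. 240] -/
theorem valuation_det_out_eq_of_mem_twistedShell (δ : GL (Fin 2) E) {a : Fin 2 → ℤ} {n m : ℤ}
    (hδ : valuation E ((δ : Matrix (Fin 2) (Fin 2) E).det) = valuation E (ϖ ^ n)) (hm : a 0 + a 1 + 2 * m = n) (q : GL (Fin 2) E ⧸ glInt 2 E)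
    (hq : q.out⁻¹ * δ * UnitaryGroup.qsInvolution σ q.out ∈
      (glInt 2 E : Set (GL (Fin 2) E)) * {zpowDiagGL hϖ.ne_zero a} * (glInt 2 E : Set (GL (Fin 2) E))) :
    valuation E ((q.out : Matrix (Fin 2) (Fin 2) E).det) = valuation E (ϖ ^ m) := by
  have h0 := hϖ.ne_zero
  obtain ⟨x, hx, k₂, hk₂, hxk⟩ := Set.mem_mul.1 hq
  obtain ⟨k₁, hk₁, z, hz, rfl⟩ := Set.mem_mul.1 hx
  rw [Set.mem_singleton_iff] at hz
  subst hz
  have hcart : k₁⁻¹ * (q.out⁻¹ * δ * UnitaryGroup.qsInvolution σ q.out) * k₂⁻¹ = zpowDiagGL h0 a := by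
    rw [← hxk]; group
  have hdet := valuation_det_eq_of_mul_mul_eq_zpowDiagGL h0 (inv_mem hk₁) (inv_mem hk₂) hcart
  have hsq := valuation_det_twistedConj_mul_sq σ hσv q.out δ
  rw [hdet, hδ, ← hm] at hsq
  have hne : valuation E (ϖ ^ (a 0 + a 1)) ≠ 0 := (Valuation.ne_zero_iff _).2 (zpow_ne_zero _ h0)
  refine eq_of_pow_two_eq (mul_left_cancel₀ hne ?_)
  rw [hsq, ← map_pow, ← map_mul, ← zpow_natCast (ϖ ^ m) 2, ← _root_.zpow_mul, ← zpow_add₀ h0]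
  congr 2
  push_cast
  ring

include hϖ in
/-- **THE `J`-TYPE OF `g • v₀` IS `ord det g (mod 2)`**: if `|det g| = |ϖ^m|` then `g • v₀` is `J`-self-dual iff `m` is even (★ FILE 2b §1 at the self-dual root `v₀ = [𝒪²]`).
[cite: Serre1980Trees, Ch. II §1.2–§1.3] -/
theorem isSelfDualLattice_glVertexAct_root_iff_even {g : GL (Fin 2) E} {m : ℤ}
    (hg : valuation E ((g : Matrix (Fin 2) (Fin 2) E).det) = valuation E (ϖ ^ m))
    (v₀ : {M : Submodule 𝒪[E] (Fin 2 → E) // IsSpecialLattice (RingHom.id E) ϖ !![(0 : E), 1; -1, 0] M})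
    (hv₀ : v₀.1 = latt (1 : Matrix (Fin 2) (Fin 2) E)) :
    IsSelfDualLattice (RingHom.id E) !![(0 : E), 1; -1, 0] (glVertexAct hϖ g v₀).1 ↔ Even m := by
  have hsd : IsSelfDualLattice (RingHom.id E) !![(0 : E), 1; -1, 0] v₀.1 :=
    (isSelfDualLattice_id_altJ_iff _).2 ⟨1, by rw [Units.val_one]; exact hv₀, by rw [Units.val_one, Matrix.det_one, map_one]⟩
  rw [isSelfDualLattice_glVertexAct_iff_of_valuation_det_eq hϖ g hg v₀, iff_true_left hsd]

end Member

/-! ## §2 The bijection `Shell(δ, a) ≃ {x : d(x, τ_δ x) = a₀ − a₁, type(x) ≡ m}` -/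

section Bijection

include hσv in
/-- **«COSETS = TYPED VERTICES»**: for `a` antitone, `|det δ| = |ϖⁿ|` and `a₀ + a₁ + 2m = n`, the map `q ↦ q.out • v₀` is a BIJECTION from the twisted Cartan shell
`Shell(δ, a) = {q ∈ GL₂(E)⧸K̃ : q.out⁻¹ δ Θ(q.out) ∈ K̃ ϖ^a K̃}` (★ J1′ letters) onto the vertices `x` with `d(x, τ_δ x) = a₀ − a₁` and `J`-type `m (mod 2)`.
Into: §1.  Injective: `q₁.out⁻¹ q₂.out ∈ Stab v₀ = E^×·K̃` (★ `glVertexAct_eq_self_iff`) with `|det q₁.out| = |det q₂.out| = |ϖ^m|` forces the scalar to be a unit.  Onto: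
`x = g₀ • v₀` (★ `exists_glVertexAct_eq`), rescale `g = ϖ^{−s} g₀` to `|det g| = |ϖ^m|` (the type of `x` gives `ord det g₀ ≡ m`), then the Cartan exponents `b` of
`g⁻¹ δ Θ(g)` (★ `exists_glInt_mul_mul_eq_zpowDiagGL`) have `b₀ − b₁ = a₀ − a₁` (★ FILE 2's dictionary) and `b₀ + b₁ = a₀ + a₁` (determinants), so `b = a`, and
`(gK̃).out = g k`, `Θ(k) ∈ K̃`. [cite: Rogawski1990, §4.10–§4.11 pp. 56–60] [cite: Kottwitz1986BaseChangeUnits, §1 pp. 239–243] -/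
theorem bijOn_twistedShell_two (δ : GL (Fin 2) E) {a : Fin 2 → ℤ} (ha : Antitone a) {n m : ℤ}
    (hδ : valuation E ((δ : Matrix (Fin 2) (Fin 2) E).det) = valuation E (ϖ ^ n)) (hm : a 0 + a 1 + 2 * m = n)
    (v₀ : {M : Submodule 𝒪[E] (Fin 2 → E) // IsSpecialLattice (RingHom.id E) ϖ !![(0 : E), 1; -1, 0] M})
    (hv₀ : v₀.1 = latt (1 : Matrix (Fin 2) (Fin 2) E)) :
    Set.BijOn (fun q : GL (Fin 2) E ⧸ glInt 2 E => glVertexAct hϖ q.out v₀)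
      {q : GL (Fin 2) E ⧸ glInt 2 E |
        q.out⁻¹ * δ * UnitaryGroup.qsInvolution σ q.out ∈
          (glInt 2 E : Set (GL (Fin 2) E)) * {zpowDiagGL hϖ.ne_zero a} * (glInt 2 E : Set (GL (Fin 2) E))}
      {x : {M : Submodule 𝒪[E] (Fin 2 → E) // IsSpecialLattice (RingHom.id E) ϖ !![(0 : E), 1; -1, 0] M} |
        (latticeTree (RingHom.id E) ϖ !![(0 : E), 1; -1, 0]).dist x (glVertexAct hϖ δ (thetaTreeIso hϖ σ hσv hσσ x)) = (a 0 - a 1).toNat ∧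
          (IsSelfDualLattice (RingHom.id E) !![(0 : E), 1; -1, 0] x.1 ↔ Even m)} := by
  have h0 := hϖ.ne_zero
  have hm0 : valuation E (ϖ ^ m) ≠ 0 := (Valuation.ne_zero_iff _).2 (zpow_ne_zero m h0)
  refine ⟨fun q hq => ?_, fun q₁ hq₁ q₂ hq₂ heq => ?_, fun x hx => ?_⟩
  · -- into
    exact ⟨dist_glVertexAct_out_root_of_mem_twistedShell hϖ σ hσv hσσ δ ha v₀ hv₀ q hq,
      isSelfDualLattice_glVertexAct_root_iff_even hϖ (valuation_det_out_eq_of_mem_twistedShell hϖ σ hσv δ hδ hm q hq) v₀ hv₀⟩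
  · -- injective
    have h₁ := valuation_det_out_eq_of_mem_twistedShell hϖ σ hσv δ hδ hm q₁ hq₁
    have h₂ := valuation_det_out_eq_of_mem_twistedShell hϖ σ hσv δ hδ hm q₂ hq₂
    simp only at heq
    have hfix : glVertexAct hϖ (q₁.out⁻¹ * q₂.out) v₀ = v₀ := by
      rw [glVertexAct_mul, ← heq, ← glVertexAct_mul, inv_mul_cancel, glVertexAct_one]
    have hv₀' : v₀.1 = latt ((1 : GL (Fin 2) E) : Matrix (Fin 2) (Fin 2) E) := by rw [Units.val_one]; exact hv₀
    obtain ⟨c, k, hk, hck⟩ := (glVertexAct_eq_self_iff hϖ 1 v₀ hv₀' _).1 hfix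
    rw [inv_one, one_mul, mul_one] at hck
    -- the scalar is a unit: `|det(q₁.out⁻¹ q₂.out)| = 1 = |c|²`
    have hc : valuation E (c : E) = 1 := by
      have hd := congrArg (fun g : GL (Fin 2) E => valuation E ((g : Matrix (Fin 2) (Fin 2) E).det)) hck
      rw [det_scalar_map_mul, Units.val_mul, Matrix.det_mul, map_mul, map_mul, map_pow, Matrix.coe_units_inv, Matrix.det_nonsing_inv,
        Ring.inverse_eq_inv', map_inv₀, h₁, h₂, inv_mul_cancel₀ hm0, valuation_det_eq_one_of_mem_glInt hk, mul_one] at hd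
      exact eq_of_pow_two_eq (by rw [one_pow]; exact hd.symm)
    have hK : q₁.out⁻¹ * q₂.out ∈ glInt 2 E := by
      rw [hck]
      exact mul_mem (scalar_map_mem_glInt hc) hk
    have hqq := QuotientGroup.eq.2 hK
    rwa [QuotientGroup.out_eq', QuotientGroup.out_eq'] at hqq
  · -- onto
    obtain ⟨hdist, htype⟩ := hx
    obtain ⟨g₀, hg₀⟩ := exists_glVertexAct_eq hϖ v₀ hv₀ x
    have hdet0 : (g₀ : Matrix (Fin 2) (Fin 2) E).det ≠ 0 := (g₀.isUnit.map Matrix.detMonoidHom).ne_zero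
    obtain ⟨e, u, hu, hdet⟩ := exists_eq_zpow_mul_of_ne_zero hϖ hdet0
    have hve : valuation E ((g₀ : Matrix (Fin 2) (Fin 2) E).det) = valuation E (ϖ ^ e) := by rw [hdet, map_mul, hu, mul_one]
    -- the type of `x` gives `e ≡ m (mod 2)`
    have htype₀ := isSelfDualLattice_glVertexAct_root_iff_even hϖ hve v₀ hv₀
    rw [hg₀] at htype₀
    obtain ⟨s, hs⟩ := Int.even_sub.2 (htype₀.symm.trans htype)
    -- rescale `g₀` to `|det g| = |ϖ^m|`
    set c : Eˣ := Units.mk0 ϖ h0 ^ (-s) with hc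
    set g : GL (Fin 2) E := c.map ((Matrix.scalar (Fin 2) : E →+* Matrix (Fin 2) (Fin 2) E) : E →* Matrix (Fin 2) (Fin 2) E) * g₀ with hg
    have hvg : valuation E ((g : Matrix (Fin 2) (Fin 2) E).det) = valuation E (ϖ ^ m) := by
      rw [hg, det_scalar_map_mul, map_mul, map_pow, hve, hc, Units.val_zpow_eq_zpow_val, Units.val_mk0, ← map_pow, ← map_mul, ← zpow_natCast,
        ← _root_.zpow_mul, ← zpow_add₀ h0]
      congr 2
      push_cast
      omega
    have hgx : glVertexAct hϖ g v₀ = x := by rw [hg, glVertexAct_scalar_mul, hg₀]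
    -- Cartan data of the twisted conjugate: `b = a`
    obtain ⟨k₁, hk₁, k₂, hk₂, b, hb, hcart⟩ := exists_glInt_mul_mul_eq_zpowDiagGL hϖ (g⁻¹ * δ * UnitaryGroup.qsInvolution σ g)
    have hdiff : b 0 - b 1 = a 0 - a 1 := by
      have hd := dist_glVertexAct_thetaTreeIso_of_mul_mul_eq_zpowDiagGL hϖ σ hσv hσσ δ g v₀ hv₀ hk₁ hk₂ hb hcart
      rw [hgx, hdist] at hd
      have hb' : (0 : ℤ) ≤ b 0 - b 1 := sub_nonneg.2 (hb (Fin.zero_le (1 : Fin 2)))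
      have ha' : (0 : ℤ) ≤ a 0 - a 1 := sub_nonneg.2 (ha (Fin.zero_le (1 : Fin 2)))
      have hcast := congrArg (fun t : ℕ => (t : ℤ)) hd
      simp only [Int.toNat_of_nonneg hb', Int.toNat_of_nonneg ha'] at hcast
      exact hcast.symm
    have hsum : b 0 + b 1 = a 0 + a 1 := by
      have hd := valuation_det_eq_of_mul_mul_eq_zpowDiagGL h0 hk₁ hk₂ hcart
      have hsq := valuation_det_twistedConj_mul_sq σ hσv g δ
      rw [hd, hvg, hδ, ← hm, ← map_pow, ← map_mul, ← zpow_natCast (ϖ ^ m) 2, ← _root_.zpow_mul, ← zpow_add₀ h0] at hsq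
      have := zpow_inj_of_valuation_eq hϖ hsq
      push_cast at this
      omega
    have hba : b = a := by
      funext i
      fin_cases i
      · show b 0 = a 0
        omega
      · show b 1 = a 1
        omega
    rw [hba] at hcart
    -- the coset `gK̃`
    obtain ⟨k, hk⟩ := QuotientGroup.mk_out_eq_mul (glInt 2 E) g
    refine ⟨(QuotientGroup.mk g : GL (Fin 2) E ⧸ glInt 2 E), ?_, ?_⟩
    · rw [Set.mem_setOf_eq, hk, _root_.mul_inv_rev, UnitaryGroup.qsInvolution_mul]
      have hh : g⁻¹ * δ * UnitaryGroup.qsInvolution σ g = k₁⁻¹ * zpowDiagGL hϖ.ne_zero a * k₂⁻¹ := by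
        rw [← hcart]
        group
      refine Set.mem_mul.2 ⟨(k : GL (Fin 2) E)⁻¹ * k₁⁻¹ * zpowDiagGL hϖ.ne_zero a,
        Set.mem_mul.2 ⟨(k : GL (Fin 2) E)⁻¹ * k₁⁻¹, mul_mem (inv_mem k.2) (inv_mem hk₁), zpowDiagGL hϖ.ne_zero a, rfl, rfl⟩,
        k₂⁻¹ * UnitaryGroup.qsInvolution σ k, mul_mem (inv_mem hk₂) (qsInvolution_mem_glInt_two σ hσv k.2), ?_⟩
      calc (k : GL (Fin 2) E)⁻¹ * k₁⁻¹ * zpowDiagGL hϖ.ne_zero a * (k₂⁻¹ * UnitaryGroup.qsInvolution σ k)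
          = (k : GL (Fin 2) E)⁻¹ * (k₁⁻¹ * zpowDiagGL hϖ.ne_zero a * k₂⁻¹) * UnitaryGroup.qsInvolution σ k := by group
        _ = (k : GL (Fin 2) E)⁻¹ * (g⁻¹ * δ * UnitaryGroup.qsInvolution σ g) * UnitaryGroup.qsInvolution σ k := by rw [hh]
        _ = (k : GL (Fin 2) E)⁻¹ * g⁻¹ * δ * (UnitaryGroup.qsInvolution σ g * UnitaryGroup.qsInvolution σ k) := by group
    · show glVertexAct hϖ (QuotientGroup.mk g : GL (Fin 2) E ⧸ glInt 2 E).out v₀ = x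
      rw [hk, glVertexAct_mul, glVertexAct_root_eq_of_mem_glInt hϖ k.2 v₀ hv₀, hgx]

include hσv in
/-- **`#Shell(δ, a) = #{x : d(x, τ_δ x) = a₀ − a₁ ∧ type(x) ≡ m}`** (`a₀ + a₁ + 2m = ord det δ`): the twisted Cartan shell of ★ J1′ counts the `τ_δ`-displaced vertices of ONE `J`-type —
so `Φ_Θ(δ, 𝟙_{K̃ϖ^aK̃}) = ν(K̃) ·` a typed displacement-shell count on the `(q_E+1)`-regular tree. [cite: Rogawski1990, §4.10–§4.11 pp. 56–60] [cite: Kottwitz1986BaseChangeUnits, §1 pp. 239–243] -/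
theorem ncard_twistedShell_two_eq_ncard_setOf_dist_and_type (δ : GL (Fin 2) E) {a : Fin 2 → ℤ} (ha : Antitone a) {n m : ℤ}
    (hδ : valuation E ((δ : Matrix (Fin 2) (Fin 2) E).det) = valuation E (ϖ ^ n)) (hm : a 0 + a 1 + 2 * m = n)
    (v₀ : {M : Submodule 𝒪[E] (Fin 2 → E) // IsSpecialLattice (RingHom.id E) ϖ !![(0 : E), 1; -1, 0] M})
    (hv₀ : v₀.1 = latt (1 : Matrix (Fin 2) (Fin 2) E)) :
    {q : GL (Fin 2) E ⧸ glInt 2 E |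
        q.out⁻¹ * δ * UnitaryGroup.qsInvolution σ q.out ∈
          (glInt 2 E : Set (GL (Fin 2) E)) * {zpowDiagGL hϖ.ne_zero a} * (glInt 2 E : Set (GL (Fin 2) E))}.ncard =
      {x : {M : Submodule 𝒪[E] (Fin 2 → E) // IsSpecialLattice (RingHom.id E) ϖ !![(0 : E), 1; -1, 0] M} |
        (latticeTree (RingHom.id E) ϖ !![(0 : E), 1; -1, 0]).dist x (glVertexAct hϖ δ (thetaTreeIso hϖ σ hσv hσσ x)) = (a 0 - a 1).toNat ∧
          (IsSelfDualLattice (RingHom.id E) !![(0 : E), 1; -1, 0] x.1 ↔ Even m)}.ncard := by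
  have hb := bijOn_twistedShell_two hϖ σ hσv hσσ δ ha hδ hm v₀ hv₀
  rw [← hb.image_eq, hb.injOn.ncard_image]

include hσv in
/-- **FINITENESS TRANSFERS**: `Shell(δ, a)` is finite iff the typed displacement shell of `τ_δ` is — the tree side (★ W8-f's `finite_setOf_dist_self_apply_eq` family, or the
fixed-tree data) PAYS the `hfin` binder of ★ J1′ ∕ K7 ∕ K8 at rank one. [cite: Kottwitz1986BaseChangeUnits, §1 p. 240] -/
theorem twistedShell_two_finite_iff (δ : GL (Fin 2) E) {a : Fin 2 → ℤ} (ha : Antitone a) {n m : ℤ}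
    (hδ : valuation E ((δ : Matrix (Fin 2) (Fin 2) E).det) = valuation E (ϖ ^ n)) (hm : a 0 + a 1 + 2 * m = n)
    (v₀ : {M : Submodule 𝒪[E] (Fin 2 → E) // IsSpecialLattice (RingHom.id E) ϖ !![(0 : E), 1; -1, 0] M})
    (hv₀ : v₀.1 = latt (1 : Matrix (Fin 2) (Fin 2) E)) :
    {q : GL (Fin 2) E ⧸ glInt 2 E |
        q.out⁻¹ * δ * UnitaryGroup.qsInvolution σ q.out ∈
          (glInt 2 E : Set (GL (Fin 2) E)) * {zpowDiagGL hϖ.ne_zero a} * (glInt 2 E : Set (GL (Fin 2) E))}.Finite ↔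
      {x : {M : Submodule 𝒪[E] (Fin 2 → E) // IsSpecialLattice (RingHom.id E) ϖ !![(0 : E), 1; -1, 0] M} |
        (latticeTree (RingHom.id E) ϖ !![(0 : E), 1; -1, 0]).dist x (glVertexAct hϖ δ (thetaTreeIso hϖ σ hσv hσσ x)) = (a 0 - a 1).toNat ∧
          (IsSelfDualLattice (RingHom.id E) !![(0 : E), 1; -1, 0] x.1 ↔ Even m)}.Finite := by
  have hb := bijOn_twistedShell_two hϖ σ hσv hσσ δ ha hδ hm v₀ hv₀
  refine ⟨fun h => hb.image_eq ▸ h.image _, fun h => Set.Finite.of_finite_image ?_ hb.injOn⟩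
  rw [hb.image_eq]
  exact h

end Bijection


end Summit.HodgeConjecture.HodgeConjecture.R90.S6

end
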